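import Summits.CriticalPhenomena.PercolationContinuityZ3.Theses.PercNonProliferation
import Summits.CriticalPhenomena.PercolationContinuityZ3.Theorems.NonProliferation.Negative.AboveSix
import Summits.CriticalPhenomena.PercolationContinuityZ3.Theorems.PercNonProliferationNonProliferationStubInnerCellCount
import Literature.Probability.Percolation.SeedLemma
import Literature.Probability.Percolation.KestenTheorem
import HarnessLib

/-!
# Crux `PercNonProliferation.NonProliferation` (stmt-CriticalPhenomena-4444), line `boundary-pinning` — stub `stub_midSphereCrossers`

Helper file for the lead's skeleton of line `boundary-pinning` (payload slug `Sketch`,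
prover-line-stmt-CriticalPhenomena-4444-c1), BULK sibling: the deterministic charging of box-distinct
annulus crossers to cells of the MID-sphere. Proves the registered stub signature
`stub_midSphereCrossers`; lands with `--supports stmt-CriticalPhenomena-4444`.

Let `R := n + k m + 1` and let `𝒬` be cells of coordinate-diameter `≤ m` contained in and covering the
mid-sphere `∂ⁱⁿB(R)`, with chosen points `z Q ∈ Q`. Given `2km + 2 ≤ n` (so `n ≤ R < 2n` and
`R + km ≤ 2n - 1`) and `k ≥ 1` (so `m ≤ km`):

* First exit (`exists_mem_innerBoundary_openConnIn`): each representative `x j ∈ B(n) ⊆ B(R)` of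
  `repEvent d (r·#𝒬) n` is joined inside `B(2n)` to some `y j ∈ ∂ⁱⁿB(2n)`, and `y j ∉ B(R)`
  (a coordinate of `y j` is `±2n`, `exists_eq_of_mem_innerBoundary_box`), so the open path leaves
  `B(R)` through a point `w j ∈ ∂ⁱⁿB(R)` joined to `x j` inside `B(R) ⊆ B(2n)`.
* Cover + pigeonhole with multiplicity (`Finset.exists_lt_card_fiber_of_mul_lt_card_of_maps_to`):
  the `r·#𝒬 + 1` points `w j` are charged to cells `c j ∋ w j`; some cell `Q` receives `r + 1` of
  them, indexed by an injection `σ : Fin (r+1) ↪ Fin (r·#𝒬+1)`.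
* The points `w (σ i) ∈ Q` lie in `z_Q + B(m)` (diameter of `Q`), hence in `z_Q + B(km)`; the target
  `y (σ i)` does not (`z_Q + B(km) ⊆ B(R + km) ⊆ B(2n-1)`), so a second first exit gives an open path
  inside `z_Q + B(km)` from `w (σ i)` to `∂ⁱⁿ(z_Q + B(km))`.
* Two of them joined inside `z_Q + B(km) ⊆ B(2n)` would join `x (σ i)` to `x (σ j)` inside `B(2n)`,
  contradicting the pairwise clause of `repEvent` (`σ` injective).
-/

noncomputable section

namespace Summit.CriticalPhenomena.PercolationContinuityZ3.Theorems.NonProliferation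

open MeasureTheory Filter Topology
open Literature.Probability.LatticeModels Literature.Probability.Percolation
open Summit.CriticalPhenomena.PercolationContinuityZ3.Theorems.NonProliferation.Negative

namespace StubMidSphereCrossers

/-- A point of the sphere `∂ⁱⁿB(N)` has a coordinate `±N`, so it is not in `B(R)` for `R < N`. -/
theorem not_mem_box_of_mem_innerBoundary {d R N : ℕ} (hRN : R < N) {y : Site d}
    (hy : y ∈ innerBoundary (zdGraph d) (box d N)) : y ∉ box d R := by
  intro h
  obtain ⟨i, hi | hi⟩ := exists_eq_of_mem_innerBoundary_box hy
  · have h2 := (mem_box.1 h i).2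
    omega
  · have h1 := (mem_box.1 h i).1
    omega

/-- The translated box `c + B(L)` around a point `c ∈ B(R)` lies in `B(R + L)`. -/
theorem ball_subset_box {d R L : ℕ} {c : Site d} (hc : c ∈ box d R) :
    GM.ball c L ⊆ box d (R + L) := by
  intro v hv
  rw [mem_box] at hc ⊢
  rw [GM.mem_ball] at hv
  intro i
  obtain ⟨h1, h2⟩ := hv i
  obtain ⟨h3, h4⟩ := hc i
  push_cast
  constructor <;> omega

/-- A point of the sphere `∂ⁱⁿB(N)` is not in `c + B(L)` when `c ∈ B(R)` and `R + L < N`. -/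
theorem not_mem_ball_of_mem_innerBoundary {d R L N : ℕ} {c : Site d} (hc : c ∈ box d R)
    (h : R + L < N) {y : Site d} (hy : y ∈ innerBoundary (zdGraph d) (box d N)) :
    y ∉ GM.ball c L :=
  fun hv => not_mem_box_of_mem_innerBoundary h hy (ball_subset_box hc hv)

/-- Translated boxes are increasing in the radius. -/
theorem ball_mono {d : ℕ} (c : Site d) {L L' : ℕ} (h : L ≤ L') : GM.ball c L ⊆ GM.ball c L' := by
  intro v hv
  rw [GM.mem_ball] at hv ⊢
  intro i
  obtain ⟨h1, h2⟩ := hv i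
  constructor <;> omega

/-- A point `u` of a cell `Q` of coordinate-diameter `≤ m` lies in `v + B(m)` for every `v ∈ Q`. -/
theorem mem_ball_of_diam {d m : ℕ} {Q : Finset (Site d)}
    (hdiam : ∀ u ∈ Q, ∀ v ∈ Q, ∀ i : Fin d, |u i - v i| ≤ (m : ℤ)) {u v : Site d} (hu : u ∈ Q)
    (hv : v ∈ Q) : u ∈ GM.ball v m :=
  GM.mem_ball.2 fun i => abs_le.1 (hdiam u hu v hv i)

end StubMidSphereCrossers

open StubMidSphereCrossers in
/-- **Stub `stub_midSphereCrossers`** of line `boundary-pinning` (crux stmt-CriticalPhenomena-4444), the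
deterministic input of the BULK sibling: with `R := n + k m + 1`, cells `𝒬` of coordinate-diameter `≤ m`
contained in and covering the mid-sphere `∂ⁱⁿB(R)` with chosen points `z Q ∈ Q`, `2km + 2 ≤ n` and
`k ≥ 1`, a lattice configuration with `r·#𝒬 + 1` box-distinct crossers of `B(2n) ∖ B(n)`
(`repEvent d (r·#𝒬) n`) has a cell `Q ∈ 𝒬` and `r + 1` points of `z_Q + B(m)`, each joined INSIDE
`z_Q + B(km)` to `∂ⁱⁿ(z_Q + B(km))`, pairwise NOT joined inside `z_Q + B(km)` (first exit through
`∂ⁱⁿB(R)`, pigeonhole with multiplicity `r`, first exit from `z_Q + B(km) ⊆ B(2n-1)`). -/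
theorem stub_midSphereCrossers :
    ∀ (d n k m r : ℕ) (𝒬 : Finset (Finset (Site d))) (z : Finset (Site d) → Site d) (ω : BondConfig (Site d)),
    1 ≤ m → 1 ≤ k → 2 * k * m + 2 ≤ n → ω ⊆ (zdGraph d).edgeSet →
    (∀ Q ∈ 𝒬, Q ⊆ innerBoundary (zdGraph d) (box d (n + k * m + 1))) →
    (∀ Q ∈ 𝒬, z Q ∈ Q) →
    (∀ Q ∈ 𝒬, ∀ u ∈ Q, ∀ v ∈ Q, ∀ i : Fin d, |u i - v i| ≤ (m : ℤ)) →
    (∀ y ∈ innerBoundary (zdGraph d) (box d (n + k * m + 1)), ∃ Q ∈ 𝒬, y ∈ Q) →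
    ω ∈ repEvent d (r * 𝒬.card) n →
    ∃ Q ∈ 𝒬, ∃ x : Fin (r + 1) → Site d, (∀ i, x i ∈ GM.ball (z Q) m) ∧
      (∀ i, ∃ y ∈ innerBoundary (zdGraph d) (GM.ball (z Q) (k * m)),
        ω ∈ openConnIn (↑(GM.ball (z Q) (k * m)) : Set (Site d)) (x i) y) ∧
      ∀ i j, i ≠ j → ω ∉ openConnIn (↑(GM.ball (z Q) (k * m)) : Set (Site d)) (x i) (x j) := by
  classical
  intro d n k m r 𝒬 z ω hm hk hn hω hQ hz hdiam hcover hrep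
  -- arithmetic of the scales: `n ≤ R < 2n`, `R + km < 2n`, `m ≤ km`
  have hkm : 2 * (k * m) + 2 ≤ n := by simpa [mul_assoc] using hn
  have hmk : m ≤ k * m := Nat.le_mul_of_pos_left m hk
  set R : ℕ := n + k * m + 1 with hR
  have hnR : n ≤ R := by omega
  have hR2 : R < 2 * n := by omega
  have hRk : R + k * m < 2 * n := by omega
  obtain ⟨x, hx, hconn, hdisj⟩ := hrep
  -- first exit through the mid-sphere `∂ⁱⁿB(R)`
  have hexit : ∀ j, ∃ w ∈ innerBoundary (zdGraph d) (box d R),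
      ω ∈ openConnIn (↑(box d R) : Set (Site d)) (x j) w := fun j => by
    obtain ⟨y, hy, hxy⟩ := hconn j
    exact exists_mem_innerBoundary_openConnIn hω (box d R) (box_mono d hnR (hx j))
      (not_mem_box_of_mem_innerBoundary hR2 hy) (StubInnerCellCount.reachable_of_mem_openConnIn hxy)
  choose w hw hxw using hexit
  have hxw2 : ∀ j, ω ∈ openConnIn (↑(box d (2 * n)) : Set (Site d)) (x j) (w j) := fun j =>
    openConnIn_mono (Finset.coe_subset.2 (box_mono d hR2.le)) _ _ (hxw j)
  -- cells `c j ∋ w j` and pigeonhole with multiplicity `r`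
  have hcell : ∀ j, ∃ Q ∈ 𝒬, w j ∈ Q := fun j => hcover (w j) (hw j)
  choose c hc hwc using hcell
  obtain ⟨Q, hQ𝒬, hfib⟩ := Finset.exists_lt_card_fiber_of_mul_lt_card_of_maps_to
    (s := (Finset.univ : Finset (Fin (r * 𝒬.card + 1)))) (t := 𝒬) (f := c) (n := r)
    (fun j _ => hc j) (by rw [Finset.card_univ, Fintype.card_fin, mul_comm]; exact Nat.lt_succ_self _)
  obtain ⟨F, hF, hFcard⟩ := Finset.exists_subset_card_eq (Nat.lt_iff_add_one_le.1 hfib)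
  obtain ⟨σ, hσF⟩ : ∃ σ : Fin (r + 1) ↪ Fin (r * 𝒬.card + 1), ∀ i, σ i ∈ F :=
    ⟨(F.orderEmbOfFin hFcard).toEmbedding, fun i => F.orderEmbOfFin_mem hFcard i⟩
  have hwQ : ∀ i, w (σ i) ∈ Q := fun i => by
    have h := (Finset.mem_filter.1 (hF (hσF i))).2
    rw [← h]
    exact hwc (σ i)
  have hzQ : z Q ∈ Q := hz Q hQ𝒬
  have hzR : z Q ∈ box d R := (mem_innerBoundary_iff.1 (hQ Q hQ𝒬 hzQ)).1
  have hballsub : (↑(GM.ball (z Q) (k * m)) : Set (Site d)) ⊆ ↑(box d (2 * n)) :=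
    Finset.coe_subset.2 ((ball_subset_box hzR).trans (box_mono d hRk.le))
  refine ⟨Q, hQ𝒬, fun i => w (σ i), fun i => mem_ball_of_diam (hdiam Q hQ𝒬) (hwQ i) hzQ,
    fun i => ?_, fun i j hij hwij => ?_⟩
  · -- an arm inside `z_Q + B(km)`: first exit towards `y (σ i) ∉ z_Q + B(km)`
    obtain ⟨y, hy, hxy⟩ := hconn (σ i)
    have hwball : w (σ i) ∈ GM.ball (z Q) (k * m) :=
      ball_mono (z Q) hmk (mem_ball_of_diam (hdiam Q hQ𝒬) (hwQ i) hzQ)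
    have hreach : (openGraph ω).Reachable (w (σ i)) y :=
      (StubInnerCellCount.reachable_of_mem_openConnIn (hxw (σ i))).symm.trans
        (StubInnerCellCount.reachable_of_mem_openConnIn hxy)
    exact exists_mem_innerBoundary_openConnIn hω (GM.ball (z Q) (k * m)) hwball
      (not_mem_ball_of_mem_innerBoundary hzR hRk hy) hreach
  · -- distinctness: joined inside `z_Q + B(km) ⊆ B(2n)` would join `x (σ i)` to `x (σ j)`
    refine hdisj (σ i) (σ j) (fun h => hij (σ.injective h)) ?_
    exact PlanarDuality.openConnIn_trans
      (PlanarDuality.openConnIn_trans (hxw2 (σ i)) (openConnIn_mono hballsub _ _ hwij))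
      (StubInnerCellCount.openConnIn_symm (hxw2 (σ j)))

end Summit.CriticalPhenomena.PercolationContinuityZ3.Theorems.NonProliferation

end
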